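import Literature.Topology.FourManifolds.LinkingNumberProofs
import HarnessLib

/-!
# The global instance `Knot.TubularNbhd.smoothnessFacts`

Topic `Literature/Topology/FourManifolds`; leaf companion of `LinkingNumber.lean` /
`LinkingNumberProofs.lean`.

The `Prop`-valued class `Literature.Topology.FourManifolds.Knot.TubularNbhd.SmoothnessFacts`
(`LinkingNumber.lean`) bundles the one deferred smoothness fact of that file,
`Knot.TubularNbhd.isSmoothEmbedding_pushOff` — the push-off `x ↦ ν (x, e₀)` of a knot along an
oriented tubular neighbourhood `ν : S¹ × ℝ² ↪ S³` is a smooth embedding `S¹ → S³` (M. W. Hirsch,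
*Differential Topology* (1976), Ch. 1 §3) — so that the construction `Knot.TubularNbhd.pushOff`
and everything built on it (`FramedLink.IsHandleSlide`, `FramedLink.IsStrictHandleSlide`,
`StrictKirbyMove`, `StrictKirbyEquivalent`, the slide facts
`FramedLink.IsStrictHandleSlide.slideModel` / `slideDiffeo` / `slideDiffeoAligned`, …) consume it
as one instance hypothesis `[Knot.TubularNbhd.SmoothnessFacts]`. The fact is *proved* in
`LinkingNumberProofs.lean` (`Knot.TubularNbhd.isSmoothEmbedding_pushOff_holds`: zero section of
the recentred equidimensional open embedding `ν`), whose module docstring leaves it to users to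
"feed it `⟨Knot.TubularNbhd.isSmoothEmbedding_pushOff_holds⟩`".

This file registers that term once and for all as the global instance

* `Literature.Topology.FourManifolds.Knot.TubularNbhd.smoothnessFacts :
  Knot.TubularNbhd.SmoothnessFacts`

(the same pattern as `SphereEmbedding.smoothnessFacts` in `KnotsProofs.lean`), so that the
discharge `theorem X_holds : X` of any named fact `X` whose statement carries the binder
`[Knot.TubularNbhd.SmoothnessFacts]` — e.g. Kirby's theorem, "if" direction (corrected),
`StrictKirbyEquivalent.nonempty_diffeomorph` (`KirbyMovesStrictHandleSlide.lean`), or the slide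
facts above — can be stated with **no binder at all** once this module is imported, and records
the binder-free form of the proved fact,

* `Literature.Topology.FourManifolds.Knot.TubularNbhd.isSmoothEmbedding_coe_pushOff`:
  for every oriented tubular neighbourhood `ν` of every knot, `⇑ν.pushOff` is a `C^∞` embedding.

It is a separate leaf module rather than an append to `LinkingNumberProofs.lean` only so as not
to re-elaborate the hundred files downstream of that module; nothing else is declared, no
statement of another file is modified, no named fact is introduced, no `sorry`.

## References

* M. W. Hirsch, *Differential Topology*, Springer GTM 33 (1976), Ch. 1 §3 (immersions and
  embeddings). [cite: Hirsch1976, Ch. 1 §3]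
* D. Rolfsen, *Knots and Links*, Publish or Perish (1976), §9.F (longitudes / push-offs).
  [cite: Rolfsen1976, §9.F]
-/

open scoped Manifold ContDiff

noncomputable section

namespace Literature.Topology.FourManifolds

/-- **All deferred smoothness facts of `LinkingNumber.lean` hold** — the global instance of the
`Prop`-valued class `Knot.TubularNbhd.SmoothnessFacts` (the push-off of a knot along an oriented
tubular neighbourhood is a smooth embedding `S¹ → S³`), inhabited by the discharge
`Knot.TubularNbhd.isSmoothEmbedding_pushOff_holds` of `LinkingNumberProofs.lean`. With this module
imported, `Knot.TubularNbhd.pushOff`, `FramedLink.IsStrictHandleSlide`, `StrictKirbyEquivalent`, …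
are available unconditionally. Hirsch (1976), Ch. 1 §3. [cite: Hirsch1976, Ch. 1 §3] -/
instance Knot.TubularNbhd.smoothnessFacts : Knot.TubularNbhd.SmoothnessFacts :=
  ⟨Knot.TubularNbhd.isSmoothEmbedding_pushOff_holds⟩

/-- **The push-off is a smooth embedding, binder-free form**: for every oriented tubular
neighbourhood `ν` of a knot `K`, the map `⇑ν.pushOff = fun x ↦ ν (x, e₀)` of the push-off knot
(now available without an instance hypothesis) is a `C^∞` embedding `S¹ → S³`. Hirsch (1976),
Ch. 1 §3; Rolfsen (1976), §9.F. [cite: Hirsch1976, Ch. 1 §3] -/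
theorem Knot.TubularNbhd.isSmoothEmbedding_coe_pushOff {K : Knot} (ν : Knot.TubularNbhd K) :
    Manifold.IsSmoothEmbedding (𝓡 1) (𝓡 3) ∞ ⇑ν.pushOff :=
  Knot.TubularNbhd.isSmoothEmbedding_pushOff_holds ν

end Literature.Topology.FourManifolds
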